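import Summits.ABC.IUTFork.Conditional.WRowUnconditionalPackages
import Summits.ABC.IUTFork.Conditional.WRowUnconditionalCellsBase
import Summits.ABC.IUTFork.Conditional.WRowUnconditionalCellsSlot
import Summits.ABC.IUTFork.Conditional.AbcOfSGenuineKWildInhabitedRow73
import HarnessLib

/-!
# R-W WINDOW-TABLE «W:FREY73-RESIDUAL» — the abc triple `73 + 2¹³·7⁷·941² = 3¹⁶·103³·127` at the level `l = 19`, part B1: the ARITHMETIC of
# the INHABITED HALF of the type-split (the hook pins `e(K_x/ℚ_7) = 30·19 = 570`; every other bad prime over its whole lower-bound class)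

PROOF-ONLY file (D-0012; 0 definitions, 0 `Prop` facts; almost pure arithmetic) of the abc-iut cell — D-0079 RESCUE sub-cell R-W «WINDOW Θ-SIDE
INEQUALITY», W1 ROW DECISIONS composer seat abc-iut-W-row-1 (gen 4), row «W:FREY73-RESIDUAL» (abc-iut-plan rulings C-R82 (a)(ii) / C-R83 (a),(b)).
It supplies the arithmetic hypothesis `hcell` of this seat's LOCAL-TYPE-HOOK socket `WRow.licence_triple_slot_of_localType`
(`Cor312LicenceTripleLocalTypeSlot`) for `(73, 2¹³7⁷941², 3¹⁶103³127)` at `l = 19` with the hook `Q p e := (p = 7 → e = 570)`: at the pole `7`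
the nine integer cells are checked at the ONE type `e = 570` (`P_q = 210`, tame different `569`, inner slot `⌊570/6⌋ = 95`, envelope exponents
`A = 3`, `B = 4`: `7³ − 3·570 = −1367`; worst margin `3050` at the top label — desk HOME/abc-iut-W-row-1/gen4/plan19.py), by `decide`; at
`p ∈ {3, 73, 103, 127, 941}` over the whole tree-lower-bound class `e = e₀·n` (`e₀ = 570, 285, 190, 570, 285`) exactly as in abc-iut-W-row-2's
`WRowFrey73SmallLevelsCellsB` (`l = 17, 23`): the floor-free END cells at `n₀ = 1` (`WRow.cell_wild_of_ends` at `3` with `A = 5`; abc-iut-W-row-1's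
`WRow.cell_tameslot_of_ends` elsewhere with `A_73 = A_127 = A_941 = 0`, `A_103 = 1`) give every multiple and every label. The OTHER type at `7`,
`e = 285 = 15·19`, FAILS the exact cell at the top label (part A, `WRowFrey73NineteenRefutedHalf`): this is why `l = 19` is a TYPE-SPLIT row and
why the unhooked sockets (`WRow.licence_triple_unconditional(_slot)`) cannot decide it. TAKES NO SIDE on [IUTchIII] Cor. 3.12 or on any author;
«inhabited as typed» ≠ «asserted in print».

WHAT IS PROVED (namespace `Summit.ABC.IUTFork.Conditional`): **`WRow.hcell_frey73_nineteen_localType30`** — the hooked socket's `hcell` for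
`(73, 2¹³7⁷941², 3¹⁶103³127)` at `l = 19`, hook `p = 7 → e = 570`. Consumer: `WRowFrey73NineteenInhabitedHalf.lean` (the licence / hull theorems of
part B). HONEST SCOPE: integer arithmetic plus the cell's typed containers; nothing here bears on the printed inequality; typed ≠ proved; no abc claim.
[cite: Mochizuki2012, IUTchI Def. 3.1 (b),(c) pp. 61–62, Rmk. 3.1.5 p. 65, Ex. 3.2 (iv) p. 71; IUTchIII Cor. 3.12 Step (xi-f) p. 184; IUTchIV Prop. 1.1 p. 9, Prop. 1.2 (i)(ii) p. 10, Prop. 1.4 (ii) p. 13, Cor. 2.2 (ii) proof (P5) p. 46]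
[cite: DupuyHilado2025, §3.3, §3.4, §4.9, §4.12] [claim: Mochizuki2012, status: disputed] for the IUT locutions only.
-/

noncomputable section

open Set Function Metric NumberField IsDedekindDomain

namespace Summit.ABC.IUTFork.Conditional

open Thm311 Thm311.Real Cor312 Cor312Vol Cor312Prov Literature.IUT.LogThetaLattice Literature.IUT.LogVolume
  Literature.IUT.HodgeTheaters Literature.IUT.LogVolume.Cor22
open Literature.NumberTheory.NumberFields Literature.NumberTheory.GaloisRepresentations.Ultrametric
open Literature.NumberTheory.DiophantineGeometry Literature.NumberTheory.DiophantineGeometry.GenEll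

/-! ## The arithmetic at `l = 19` with the pole `7` pinned to `e = 570` -/

/-- **The hooked socket's arithmetic hypothesis `hcell` for `(73, 2¹³7⁷941², 3¹⁶103³127)` at `l = 19`, hook `Q p e := (p = 7 → e = 570)`**:
exponents `A_3 = 5`, `A_7 = 3`, `A_103 = 1`, `A_73 = A_127 = A_941 = 0` (`B = A + 1`); at `7` the nine cells at the single type `570` (`decide`),
elsewhere every multiple of the class generator from the two floor-free END cells (`WRow.cell_wild_of_ends` / `WRow.cell_tameslot_of_ends`). [folklore] -/
theorem WRow.hcell_frey73_nineteen_localType30 :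
    ∀ p : ℕ, p.Prime → p ∣ 73 * 5973865915867136 * 5973865915867209 → p ≠ 2 → p ≠ 19 → ∀ e : ℕ, 0 < e → 19 ∣ e →
      15 * 19 ∣ e * (73 * 5973865915867136 * 5973865915867209).factorization p → (p ∣ 30 → (p - 1) ∣ e) →
      (p ∣ 5973865915867209 → Odd ((73 * 5973865915867136 * 5973865915867209).factorization p) → 30 * 19 ∣ e * (73 * 5973865915867136 * 5973865915867209).factorization p) → (p = 7 → e = 570) →
      (∀ k : ℕ, (e : ℤ) ≠ (p : ℤ) ^ k * ((p : ℤ) - 1)) ∧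
      ∀ i : ℕ, i < (19 - 1) / 2 →
        (e : ℤ) * ((((i + 1 : ℕ) : ℤ) ^ 2 * ((e * (2 * (73 * 5973865915867136 * 5973865915867209).factorization p) / (2 * 19) : ℕ) : ℤ) -
            ((i + 1 : ℕ) : ℤ) * (((if p ∣ 30 ∧ ¬ p ∣ (73 * 5973865915867136 * 5973865915867209).factorization p then 2 * e - 1 else e - 1 : ℕ) : ℕ) : ℤ) -
            ((i + 2 : ℕ) : ℤ) * ((((max 1 (e / (p - 1))) : ℕ) : ℤ))) / (e : ℤ)) +
          ((i + 2 : ℕ) : ℤ) * min ((p : ℤ) ^ (if p = 3 then 5 else if p = 7 then 3 else if p = 103 then 1 else 0) - ((if p = 3 then 5 else if p = 7 then 3 else if p = 103 then 1 else 0 : ℕ) : ℤ) * (e : ℤ))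
            ((p : ℤ) ^ (if p = 3 then 6 else if p = 7 then 4 else if p = 103 then 2 else 1) - ((if p = 3 then 6 else if p = 7 then 4 else if p = 103 then 2 else 1 : ℕ) : ℤ) * (e : ℤ)) ≤
        ((e * (2 * (73 * 5973865915867136 * 5973865915867209).factorization p) / (2 * 19) : ℕ) : ℤ) := by
  intro p hp hpabc h2 _hpl e he _hle h15 h30 hodd hq
  rcases eq_of_prime_dvd_triple_73 hp hpabc with rfl | rfl | rfl | rfl | rfl | rfl | rfl
  · exact absurd rfl h2
  · -- `p = 3`: `e = 570·n`, `A = 5`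
    rw [factorization_triple_73.1] at h15 hodd ⊢
    norm_num at h15
    have hm : 285 ∣ e := Nat.Coprime.dvd_of_dvd_mul_right (by norm_num : Nat.Coprime 285 16) h15
    have hpe : 2 ∣ e := by have := h30 (by norm_num); norm_num at this; exact this
    have he0 : 570 ∣ e := by
      have := Nat.Coprime.mul_dvd_of_dvd_of_dvd (by norm_num : Nat.Coprime 285 2) hm hpe
      rwa [show (285 : ℕ) * 2 = 570 by norm_num] at this
    obtain ⟨n, rfl⟩ := he0
    have hn : 1 ≤ n := by omega
    refine ⟨WRow.natCast_ne_pow_mul_sub_one (by norm_num : Nat.Prime 5) (by norm_num) (by norm_num) (by norm_num) ⟨114 * n, by ring⟩,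
      fun i hi => ?_⟩
    rw [if_pos ⟨by norm_num, by norm_num⟩, max_eq_right (show 1 ≤ 570 * n / (3 - 1) by omega)]
    simp only [ite_true]
    refine WRow.cell_wild_of_ends ((3 : ℕ) : ℤ) 570 (3 - 1) (2 * 16) (2 * 19) 5 6 9 (by norm_num) (by norm_num) (by norm_num) (by norm_num)
      (by norm_num) (by norm_num) ?_ hi hn
    rintro i (rfl | hi')
    · norm_num
    · obtain rfl : i = 8 := by omega
      norm_num
  · -- `p = 7`: the hook pins `e = 570` (= 30·19); exponents `A = 3`, `B = 4`; the nine exact cells by `decide`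
    rw [factorization_triple_73.2.1]
    obtain rfl : e = 570 := hq rfl
    refine ⟨WRow.natCast_ne_pow_mul_sub_one (by norm_num : Nat.Prime 5) (by norm_num) (by norm_num) (by norm_num) ⟨114, by norm_num⟩,
      fun i hi => ?_⟩
    rw [if_neg (by norm_num : ¬ ((7 : ℕ) ∣ 30 ∧ ¬ (7 : ℕ) ∣ 7))]
    simp only [show ((7 : ℕ) = 3) = False from eq_false (by decide), ite_true, ite_false]
    norm_num at hi
    interval_cases i <;> decide +kernel
  · -- `p = 73`: `e = 285·n`, `A = 0`
    rw [factorization_triple_73.2.2.1] at h15 hodd ⊢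
    norm_num at h15
    obtain ⟨n, rfl⟩ := h15
    have hn : 1 ≤ n := by omega
    refine ⟨WRow.natCast_ne_pow_mul_sub_one (by norm_num : Nat.Prime 5) (by norm_num) (by norm_num) (by norm_num) ⟨57 * n, by ring⟩,
      fun i hi => ?_⟩
    rw [if_neg (by norm_num : ¬ ((73 : ℕ) ∣ 30 ∧ ¬ (73 : ℕ) ∣ 1))]
    simp only [show ((73 : ℕ) = 3) = False from eq_false (by decide), show ((73 : ℕ) = 7) = False from eq_false (by decide), show ((73 : ℕ) = 103) = False from eq_false (by decide), ite_false]
    refine WRow.cell_tameslot_of_ends ((73 : ℕ) : ℤ) 285 (73 - 1) 3 (2 * 1) (2 * 19) 0 1 9 1 (by norm_num) (by norm_num) (by norm_num)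
      (by norm_num) (by norm_num) (by norm_num) le_rfl ?_ hi hn
    rintro i (rfl | hi')
    · norm_num
    · obtain rfl : i = 8 := by omega
      norm_num
  · -- `p = 103`: `e = 190·n`, `A = 1`
    rw [factorization_triple_73.2.2.2.1] at h15 hodd ⊢
    have hT := hodd (by norm_num) (by decide)
    norm_num at hT
    rw [show (570 : ℕ) = 190 * 3 by norm_num] at hT
    obtain ⟨n, rfl⟩ := Nat.dvd_of_mul_dvd_mul_right (by norm_num) hT
    have hn : 1 ≤ n := by omega
    refine ⟨WRow.natCast_ne_pow_mul_sub_one (by norm_num : Nat.Prime 5) (by norm_num) (by norm_num) (by norm_num) ⟨38 * n, by ring⟩,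
      fun i hi => ?_⟩
    rw [if_neg (by norm_num : ¬ ((103 : ℕ) ∣ 30 ∧ ¬ (103 : ℕ) ∣ 3))]
    simp only [show ((103 : ℕ) = 3) = False from eq_false (by decide), show ((103 : ℕ) = 7) = False from eq_false (by decide), ite_true, ite_false]
    refine WRow.cell_tameslot_of_ends ((103 : ℕ) : ℤ) 190 (103 - 1) 1 (2 * 3) (2 * 19) 1 2 9 1 (by norm_num) (by norm_num) (by norm_num)
      (by norm_num) (by norm_num) (by norm_num) le_rfl ?_ hi hn
    rintro i (rfl | hi')
    · norm_num
    · obtain rfl : i = 8 := by omega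
      norm_num
  · -- `p = 127`: `e = 570·n`, `A = 0`
    rw [factorization_triple_73.2.2.2.2.1] at h15 hodd ⊢
    have hT := hodd (by norm_num) (by decide)
    norm_num at hT
    obtain ⟨n, rfl⟩ := hT
    have hn : 1 ≤ n := by omega
    refine ⟨WRow.natCast_ne_pow_mul_sub_one (by norm_num : Nat.Prime 5) (by norm_num) (by norm_num) (by norm_num) ⟨114 * n, by ring⟩,
      fun i hi => ?_⟩
    rw [if_neg (by norm_num : ¬ ((127 : ℕ) ∣ 30 ∧ ¬ (127 : ℕ) ∣ 1))]
    simp only [show ((127 : ℕ) = 3) = False from eq_false (by decide), show ((127 : ℕ) = 7) = False from eq_false (by decide), show ((127 : ℕ) = 103) = False from eq_false (by decide), ite_false]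
    refine WRow.cell_tameslot_of_ends ((127 : ℕ) : ℤ) 570 (127 - 1) 4 (2 * 1) (2 * 19) 0 1 9 1 (by norm_num) (by norm_num) (by norm_num)
      (by norm_num) (by norm_num) (by norm_num) le_rfl ?_ hi hn
    rintro i (rfl | hi')
    · norm_num
    · obtain rfl : i = 8 := by omega
      norm_num
  · -- `p = 941`: `e = 285·n`, `A = 0`
    rw [factorization_triple_73.2.2.2.2.2] at h15 hodd ⊢
    norm_num at h15
    obtain ⟨n, rfl⟩ := Nat.Coprime.dvd_of_dvd_mul_right (by norm_num : Nat.Coprime 285 2) h15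
    have hn : 1 ≤ n := by omega
    refine ⟨WRow.natCast_ne_pow_mul_sub_one (by norm_num : Nat.Prime 3) (by norm_num) (by norm_num) (by norm_num) ⟨95 * n, by ring⟩,
      fun i hi => ?_⟩
    rw [if_neg (by norm_num : ¬ ((941 : ℕ) ∣ 30 ∧ ¬ (941 : ℕ) ∣ 2))]
    simp only [show ((941 : ℕ) = 3) = False from eq_false (by decide), show ((941 : ℕ) = 7) = False from eq_false (by decide), show ((941 : ℕ) = 103) = False from eq_false (by decide), ite_false]
    refine WRow.cell_tameslot_of_ends ((941 : ℕ) : ℤ) 285 (941 - 1) 0 (2 * 2) (2 * 19) 0 1 9 1 (by norm_num) (by norm_num) (by norm_num)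
      (by norm_num) (by norm_num) (by norm_num) le_rfl ?_ hi hn
    rintro i (rfl | hi')
    · norm_num
    · obtain rfl : i = 8 := by omega
      norm_num

end Summit.ABC.IUTFork.Conditional

end
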